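import Summits.Ventures.HodgeRepro2.T5AbelianWeightIndependence
import Summits.Ventures.HodgeRepro2.T5WeightOrthogonality

/-!
# The character determines a representation of a compact abelian group

For continuous finite-dimensional representations `π`, `π'` of a compact Hausdorff COMMUTATIVE
group `K`:

* every weight `χ` of `π` is continuous and unimodular (it is the `lineWeight` of the stable line
  spanned by any non-zero weight vector);
* equal characters give equal weight multiplicities `dim V_χ = dim V'_χ` for every character `χ`
  (`T5WeightSpaces.finrank_weightSpace_eq_integral` against the normalised Haar measure
  `Measure.haarMeasure ⊤`: both are `∫ χ_π · conj χ dμ`);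
* hence an intertwining linear equivalence `e : V ≃ₗ[ℂ] V'` is CONSTRUCTED from the two weight
  decompositions `V = ⨁_χ V_χ`, `V' = ⨁_χ V'_χ` (`T5AbelianWeightIndependence.isInternal_weightSpace`)
  by matching bases of the weight spaces of equal dimension;
* conversely equivalent representations have the same character (`LinearMap.trace_conj'`).

This is the general compact-ABELIAN form of `T5CircleCharacterDetermines` (there `K = Circle`), i.e.
the converse of `T5CharacterDetermines.equivCount_eq_of_character_eq` in the abelian case.

Blind lane: Mathlib + own prefix only; no sorry; axioms ⊆ {propext, Classical.choice, Quot.sound}.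
-/

namespace Summit.Ventures.HodgeRepro2.T5AbelianCharacterDetermines

open T5WeightSpaces T5WeightDecomposition T5AbelianWeightIndependence MeasureTheory

variable {K : Type*} [Group K] [IsMulCommutative K]
  {V : Type*} [NormedAddCommGroup V] [InnerProductSpace ℂ V] [FiniteDimensional ℂ V]

section WeightVector

variable (π : K →* V →L[ℂ] V) {χ : K →* ℂˣ} {v : V}

omit [IsMulCommutative K] [FiniteDimensional ℂ V] in
/-- The line spanned by a weight vector is stable. -/
theorem isStable_span_singleton (hv : ∀ k, π k v = ((χ k : ℂˣ) : ℂ) • v) :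
    T5CompleteReducibility.IsStable π (ℂ ∙ v) := by
  intro k x hx
  obtain ⟨c, rfl⟩ := Submodule.mem_span_singleton.1 hx
  rw [map_smul, hv k, Submodule.mem_span_singleton]
  exact ⟨c * (χ k : ℂ), by rw [mul_smul]⟩

omit [IsMulCommutative K] in
/-- The line spanned by a non-zero weight vector is an irreducible stable subspace. -/
theorem isIrreducibleSubspace_span_singleton (hv0 : v ≠ 0)
    (hv : ∀ k, π k v = ((χ k : ℂˣ) : ℂ) • v) :
    T5CompleteReducibility.IsIrreducibleSubspace π (ℂ ∙ v) :=
  T5WeightOrthogonality.isIrreducibleSubspace_of_finrank_eq_one π (isStable_span_singleton π hv)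
    (finrank_span_singleton hv0)

/-- The `lineWeight` of the line spanned by a non-zero weight vector of weight `χ` is `χ`. -/
theorem lineWeight_span_singleton (hv0 : v ≠ 0) (hv : ∀ k, π k v = ((χ k : ℂˣ) : ℂ) • v) :
    lineWeight π (isIrreducibleSubspace_span_singleton π hv0 hv) = χ := by
  set hW := isIrreducibleSubspace_span_singleton π hv0 hv
  obtain ⟨c, hc⟩ := Submodule.mem_span_singleton.1 (lineVector_mem π hW)
  have hne : c • v ≠ 0 := hc ▸ lineVector_ne_zero π hW
  refine MonoidHom.ext fun k => Units.ext ?_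
  have h1 := apply_lineVector π hW k
  rw [← hc, map_smul, hv k, smul_comm c ((χ k : ℂˣ) : ℂ) v] at h1
  exact (smul_left_injective ℂ hne h1).symm

section Compact

variable [TopologicalSpace K] [IsTopologicalGroup K] [MeasurableSpace K] [BorelSpace K]
  [CompactSpace K] [T2Space K]

omit [IsTopologicalGroup K] [MeasurableSpace K] [BorelSpace K] [CompactSpace K] [T2Space K] in
/-- A weight with a non-zero weight vector is continuous (for a continuous `π`). -/
theorem continuous_of_weightVector (hπ : Continuous π) (hv0 : v ≠ 0)
    (hv : ∀ k, π k v = ((χ k : ℂˣ) : ℂ) • v) : Continuous fun k => ((χ k : ℂˣ) : ℂ) := by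
  have := continuous_lineWeight π hπ (isIrreducibleSubspace_span_singleton π hv0 hv)
  rwa [lineWeight_span_singleton π hv0 hv] at this

/-- A weight with a non-zero weight vector is unimodular (for a continuous `π`). -/
theorem norm_eq_one_of_weightVector (hπ : Continuous π) (hv0 : v ≠ 0)
    (hv : ∀ k, π k v = ((χ k : ℂˣ) : ℂ) • v) (k : K) : ‖((χ k : ℂˣ) : ℂ)‖ = 1 := by
  have := norm_lineWeight_eq_one π hπ (isIrreducibleSubspace_span_singleton π hv0 hv) k
  rwa [lineWeight_span_singleton π hv0 hv] at this

end Compact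

end WeightVector

section Compact

variable [TopologicalSpace K] [IsTopologicalGroup K] [MeasurableSpace K] [BorelSpace K]
  [CompactSpace K] [T2Space K]

omit [IsTopologicalGroup K] [MeasurableSpace K] [BorelSpace K] [CompactSpace K] [T2Space K] in
/-- Every weight of a continuous representation is continuous. -/
theorem continuous_of_mem_weights (π : K →* V →L[ℂ] V) (hπ : Continuous π) {χ : K →* ℂˣ}
    (hχ : χ ∈ weights π) : Continuous fun k => ((χ k : ℂˣ) : ℂ) := by
  obtain ⟨v, hv0, hv⟩ := exists_line_of_mem_weights π hχ
  exact continuous_of_weightVector π hπ hv0 hv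

/-- Every weight of a continuous representation is unimodular. -/
theorem norm_eq_one_of_mem_weights (π : K →* V →L[ℂ] V) (hπ : Continuous π) {χ : K →* ℂˣ}
    (hχ : χ ∈ weights π) (k : K) : ‖((χ k : ℂˣ) : ℂ)‖ = 1 := by
  obtain ⟨v, hv0, hv⟩ := exists_line_of_mem_weights π hχ
  exact norm_eq_one_of_weightVector π hπ hv0 hv k

omit [IsMulCommutative K] [T2Space K] in
/-- The normalised Haar measure `Measure.haarMeasure ⊤` of a compact group is a probability
measure. -/
theorem isProbabilityMeasure_haarMeasure_top :
    IsProbabilityMeasure (Measure.haarMeasure (⊤ : TopologicalSpace.PositiveCompacts K)) := by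
  refine ⟨?_⟩
  rw [← TopologicalSpace.PositiveCompacts.coe_top, Measure.haarMeasure_self]

variable {V' : Type*} [NormedAddCommGroup V'] [InnerProductSpace ℂ V'] [FiniteDimensional ℂ V']

omit [IsMulCommutative K] [T2Space K] in
/-- For a continuous unimodular `χ`, equal characters give equal multiplicities of `χ` (both are
`∫ χ_π · conj χ dμ` for any left-invariant probability measure `μ`). -/
theorem finrank_weightSpace_eq_of_character_eq_of_continuous (μ : Measure K)
    [IsProbabilityMeasure μ] [μ.IsMulLeftInvariant] (π : K →* V →L[ℂ] V)
    (π' : K →* V' →L[ℂ] V') (hπ : Continuous π) (hπ' : Continuous π')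
    (h : T5SchurOrthogonality.character π = T5SchurOrthogonality.character π') (χ : K →* ℂˣ)
    (hc : Continuous fun k => ((χ k : ℂˣ) : ℂ)) (hn : ∀ k, ‖((χ k : ℂˣ) : ℂ)‖ = 1) :
    Module.finrank ℂ (weightSpace π χ) = Module.finrank ℂ (weightSpace π' χ) := by
  have e1 := finrank_weightSpace_eq_integral μ π χ hπ hc hn
  have e2 := finrank_weightSpace_eq_integral μ π' χ hπ' hc hn
  rw [h] at e1
  exact_mod_cast e1.trans e2.symm

/-- **Equal characters give equal weight multiplicities** for every character `χ`:
`dim V_χ = dim V'_χ` (if `χ` occurs in neither representation both are `0`; otherwise `χ` is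
continuous and unimodular and both are `∫ χ_π · conj χ` against the normalised Haar measure). -/
theorem finrank_weightSpace_eq_of_character_eq (π : K →* V →L[ℂ] V) (π' : K →* V' →L[ℂ] V')
    (hπ : Continuous π) (hπ' : Continuous π')
    (h : T5SchurOrthogonality.character π = T5SchurOrthogonality.character π') (χ : K →* ℂˣ) :
    Module.finrank ℂ (weightSpace π χ) = Module.finrank ℂ (weightSpace π' χ) := by
  haveI := isProbabilityMeasure_haarMeasure_top (K := K)
  set μ := Measure.haarMeasure (⊤ : TopologicalSpace.PositiveCompacts K)
  by_cases hχ : χ ∈ weights π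
  · exact finrank_weightSpace_eq_of_character_eq_of_continuous μ π π' hπ hπ' h χ
      (continuous_of_mem_weights π hπ hχ) (norm_eq_one_of_mem_weights π hπ hχ)
  by_cases hχ' : χ ∈ weights π'
  · exact finrank_weightSpace_eq_of_character_eq_of_continuous μ π π' hπ hπ' h χ
      (continuous_of_mem_weights π' hπ' hχ') (norm_eq_one_of_mem_weights π' hπ' hχ')
  rw [mem_weights_iff_finrank_ne_zero, not_not] at hχ hχ'
  rw [hχ, hχ']

/-- **The character determines the representation** (compact abelian groups): two continuous
finite-dimensional representations with the same character are equivalent — an intertwining linear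
equivalence is constructed by matching bases of the weight spaces of equal dimension in the weight
decompositions `V = ⨁_χ V_χ`, `V' = ⨁_χ V'_χ`. -/
theorem exists_linearEquiv_of_character_eq (π : K →* V →L[ℂ] V) (π' : K →* V' →L[ℂ] V')
    (hπ : Continuous π) (hπ' : Continuous π')
    (h : T5SchurOrthogonality.character π = T5SchurOrthogonality.character π') :
    ∃ e : V ≃ₗ[ℂ] V', ∀ (k : K) (v : V), e (π k v) = π' k (e v) := by
  classical
  have hint := isInternal_weightSpace π hπ
  have hint' := isInternal_weightSpace π' hπ'
  have hdim : ∀ χ : K →* ℂˣ,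
      Module.finrank ℂ (weightSpace π χ) = Module.finrank ℂ (weightSpace π' χ) :=
    finrank_weightSpace_eq_of_character_eq π π' hπ hπ' h
  let b := hint.collectedBasis fun χ => Module.finBasis ℂ (weightSpace π χ)
  let b' := hint'.collectedBasis fun χ =>
    (Module.finBasis ℂ (weightSpace π' χ)).reindex (finCongr (hdim χ)).symm
  let e : V ≃ₗ[ℂ] V' := b.equiv b' (Equiv.refl _)
  refine ⟨e, fun k v => ?_⟩
  have key : ∀ a, e (π k (b a)) = π' k (e (b a)) := by
    intro a
    have hb : b a ∈ weightSpace π a.1 := hint.collectedBasis_mem _ a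
    have hb' : b' a ∈ weightSpace π' a.1 := hint'.collectedBasis_mem _ a
    rw [(mem_weightSpace π _).1 hb k, map_smul]
    simp only [e, Module.Basis.equiv_apply, Equiv.refl_apply]
    rw [(mem_weightSpace π' _).1 hb' k]
  have : ((e : V →ₗ[ℂ] V') ∘ₗ (π k : V →ₗ[ℂ] V)) =
      ((π' k : V' →ₗ[ℂ] V') ∘ₗ (e : V →ₗ[ℂ] V')) := b.ext fun a => key a
  exact LinearMap.congr_fun this v

omit [IsMulCommutative K] [FiniteDimensional ℂ V] [FiniteDimensional ℂ V'] [TopologicalSpace K]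
  [IsTopologicalGroup K] [MeasurableSpace K] [BorelSpace K] [CompactSpace K] [T2Space K] in
/-- Equivalent representations have the same character (the trace is conjugation-invariant). -/
theorem character_eq_of_linearEquiv (π : K →* V →L[ℂ] V) (π' : K →* V' →L[ℂ] V')
    (e : V ≃ₗ[ℂ] V') (he : ∀ (k : K) (v : V), e (π k v) = π' k (e v)) :
    T5SchurOrthogonality.character π = T5SchurOrthogonality.character π' := by
  funext k
  have : (π' k : V' →ₗ[ℂ] V') = e.conj (π k : V →ₗ[ℂ] V) := by
    ext w
    rw [LinearEquiv.conj_apply_apply, ContinuousLinearMap.coe_coe, ContinuousLinearMap.coe_coe,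
      he k (e.symm w), LinearEquiv.apply_symm_apply]
  change LinearMap.trace ℂ V (π k : V →ₗ[ℂ] V) = LinearMap.trace ℂ V' (π' k : V' →ₗ[ℂ] V')
  rw [this, LinearMap.trace_conj']

/-- **Equivalent ⟺ same character**, for continuous finite-dimensional representations of a compact
Hausdorff commutative group. -/
theorem exists_linearEquiv_iff_character_eq (π : K →* V →L[ℂ] V) (π' : K →* V' →L[ℂ] V')
    (hπ : Continuous π) (hπ' : Continuous π') :
    (∃ e : V ≃ₗ[ℂ] V', ∀ (k : K) (v : V), e (π k v) = π' k (e v)) ↔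
      T5SchurOrthogonality.character π = T5SchurOrthogonality.character π' :=
  ⟨fun ⟨e, he⟩ => character_eq_of_linearEquiv π π' e he,
    fun h => exists_linearEquiv_of_character_eq π π' hπ hπ' h⟩

end Compact

end Summit.Ventures.HodgeRepro2.T5AbelianCharacterDetermines
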